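import Literature.AnabelianGeometry.EtaleTheta.Discharge.Sec4NonVacuityCoveringRoots
import Literature.AlgebraicGeometry.Frobenioids.ModelFrobenioidIsFrobenioid
import Literature.AlgebraicGeometry.Frobenioids.ElementaryFrobeniusCompact
import Literature.AnabelianGeometry.EtaleTheta.BiKummerThm44SubProofs
import Literature.AnabelianGeometry.EtaleTheta.Discharge.Sec4Thm44
import HarnessLib

/-!
# [EtTh] §4 with a COVERING: the Kummer-tower toy IS a Frobenioid and Thm 4.4 (i)–(iv) fire on it —
# the whole typed §4 picture at ONE setting (consistency witness, part 6 — conclusion)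

S. Mochizuki, *The étale theta function and its Frobenioid-theoretic manifestations*, Publ. RIMS **45**
(2009) [MochizukiEtTh2009], §4: Prop 4.2 p.88, Prop 4.3 pp.90–91, Thm 4.4 pp.93–95 (PDF); [FrdI] Thm 5.2 (ii)
p.101 ("the model Frobenioid is a Frobenioid").

CONSISTENCY WITNESS, TOY — joint satisfiability; consistency ≠ faithfulness.  Conclusion of the Kummer-tower
toy programme (`Sec4NonVacuityCovering.lean` p427822 — data, REAL `μ_N`-saturation;
`Sec4NonVacuityCoveringRoots.lean` p428415 — L01a holds, Prop 4.2 (iii) by the sub-DAG, Props 4.2/4.3).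
PROOF-ONLY (no definition, no named fact, no instance, no `sorry`):

* `ToyCov.divisorMonoid_isMonoidOn`, `ToyCov.ratFnFunctor_isMonoidOn` — `Φ = ℚ_{≥0}` and
  `B = ℂˣ × (ℚ_{≥0})^gp` are MONOIDS ON THE BASE in the sense of [FrdI] Def 1.1 (ii): every pull-back (along
  the degree-`N` cover: `× N` on exponents) is bijective — for `B` this is the unique `N`-divisibility of the
  groupification of a perfect cancellative monoid (`pow_bijective_gp`, private);
* `ToyCov.temperedFrobenioid_isFrobenioid` — the toy IS a Frobenioid (REAL `PreFrobenioid.IsFrobenioid`,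
  L1's [FrdI] Thm 5.2 (ii) `ModelFrobenioid.isFrobenioid`);
* `ToyCov.thm44_id` — for the identity self-equivalence (`Ψ = Ψ^bs = 𝟭`, built inline) the cell's Thm 4.4
  closers FIRE: `Thm44_i` (abc-iut-w5-d179's `thm44_i_of_inputs`), `Thm44_ii` (`thm44_ii_of_subnodes`),
  `Thm44_iii` (`thm44_iii_of_inputs`), `Thm44_iv` (abc-iut-L2-t3's `thm44_iv_of_prop43_ii` ∘ `ToyCov.prop43_ii`);
* `ToyCov.sec4_picture_with_roots` — **at ONE explicit `BiKummerSetting` which IS a Frobenioid and at which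
  the covering input L01a HOLDS, the typed Prop 4.2 (i)(ii)(iii)(iv), Prop 4.3 (ii)(iii) and Thm 4.4
  (i)(ii)(iii)(iv) hold SIMULTANEOUSLY** — the typed §4 statement set INCLUDING (iii) is jointly consistent
  with the setting axioms, and every landed §4 closer has a jointly satisfiable hypothesis list (row «§4 TOY
  WITH A COVERING», abc-iut-L2-lead RULINGS #9 (R75)).  Compare `Toy.sec4_picture` (p423740: the same minus
  (iii)) and `Toy.not_prop42_iii` (p422428: (iii) fails without the extra input).

HONEST LIMITS as in parts 6a/6b (one base object — the Kummer tower collapsed to its endomorphism monoid, hence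
divisible exponents; trivial [FrdI] vocabularies; `(N,H)`-slot `True`; `Π^tp` trivial over `ℚ̄`; not a curve;
typed ≠ proved).  Nothing here bears on, or takes a side on, [IUTchIII] Cor. 3.12.
-/

noncomputable section

namespace Literature.AnabelianGeometry.EtaleTheta

open CategoryTheory Opposite Literature.AlgebraicGeometry.Frobenioids
open scoped NNRat

namespace ToyCov

/-! ## `Φ` and `B` are monoids on the base; the toy is a Frobenioid -/

/-- Every element of `M^gp` is a fraction `a / b`. [folklore] -/
private theorem exists_of_div_of {M : Type} [CommMonoid M] (z : Algebra.GrothendieckGroup M) :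
    ∃ a b : M, z = Algebra.GrothendieckGroup.of a / Algebra.GrothendieckGroup.of b := by
  induction z using Localization.induction_on with
  | H y =>
    refine ⟨y.1, y.2.1, ?_⟩
    rw [div_eq_mul_inv]
    change Localization.mk y.1 y.2 = Localization.mk y.1 1 * (Localization.mk (y.2 : M) 1)⁻¹
    rw [Algebra.GrothendieckGroup.inv_mk, Localization.mk_mul]
    congr 1
    · rw [OneMemClass.coe_one, mul_one]
    · rw [one_mul]

/-- For a perfect cancellative monoid `M`, the `N`-th power map of `M^gp` is bijective. [folklore] -/
private theorem pow_bijective_gp {M : Type} [CommMonoid M] [IsCancelMul M] (hM : IsPerfect M) (N : ℕ+) :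
    Function.Bijective fun z : Algebra.GrothendieckGroup M => z ^ (N : ℕ) := by
  obtain ⟨hinj, hsurj⟩ := hM.1 (N : ℕ) (PNat.pos N)
  constructor
  · -- injective: trivial kernel
    have key : ∀ z : Algebra.GrothendieckGroup M, z ^ (N : ℕ) = 1 → z = 1 := by
      intro z hz
      obtain ⟨a, b, rfl⟩ := exists_of_div_of z
      rw [div_pow, ← map_pow, ← map_pow, div_eq_one] at hz
      rw [div_eq_one]
      exact congrArg Algebra.GrothendieckGroup.of (hinj (Algebra.GrothendieckGroup.of_injective hz))
    intro x y hxy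
    have h : (x / y) ^ (N : ℕ) = 1 := by
      rw [div_pow, div_eq_one]
      exact hxy
    exact div_eq_one.mp (key _ h)
  · intro z
    obtain ⟨a, b, rfl⟩ := exists_of_div_of z
    obtain ⟨a', ha'⟩ := hsurj a
    obtain ⟨b', hb'⟩ := hsurj b
    refine ⟨Algebra.GrothendieckGroup.of a' / Algebra.GrothendieckGroup.of b', ?_⟩
    change (Algebra.GrothendieckGroup.of a' / Algebra.GrothendieckGroup.of b') ^ (N : ℕ) = _
    rw [div_pow, ← map_pow, ← map_pow]
    exact congrArg₂ (fun u v => Algebra.GrothendieckGroup.of u / Algebra.GrothendieckGroup.of v) ha' hb'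

/-- Pull-back of divisors along a base endomorphism of degree `n` is the `n`-th power map, on `Φ(A)^gp`.
[cite: MochizukiEtTh2009, Def 3.3 p.73] -/
theorem gpMap_pull {A : Base} (f : A ⟶ A) (ξ : Algebra.GrothendieckGroup (temperedFrobenioid.Φ.carrier (op A))) :
    gpMap (temperedFrobenioid.Φ.pull f.op) ξ = ξ ^ ((deg f : ℕ+) : ℕ) := by
  have h : temperedFrobenioid.Φ.pull f.op = powMonoidHom ((deg f : ℕ+) : ℕ) :=
    MonoidHom.ext fun x => Subtype.ext rfl
  have h2 : gpMap (powMonoidHom ((deg f : ℕ+) : ℕ) : temperedFrobenioid.Φ.carrier (op A) →* _) =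
      powMonoidHom ((deg f : ℕ+) : ℕ) := by
    apply Algebra.GrothendieckGroup.lift.symm.injective
    rw [Algebra.GrothendieckGroup.lift_symm_apply, Algebra.GrothendieckGroup.lift_symm_apply]
    ext m
    change gpMap (powMonoidHom _) (Algebra.GrothendieckGroup.of m) = Algebra.GrothendieckGroup.of m ^ _
    rw [gpMap_of, powMonoidHom_apply, map_pow]
  rw [h, h2]
  rfl

/-- `Φ = ℚ_{≥0}` is a monoid on the base ([FrdI] Def 1.1 (ii)): every pull-back (`× N`) is bijective
(`ℚ_{≥0}` is perfect). [cite: MochizukiEtTh2009, Def 3.6 p.77] -/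
theorem divisorMonoid_isMonoidOn : IsMonoidOn temperedFrobenioid.divisorMonoid :=
  isMonoidOn_of_bijective fun {A B} f => by
    cases Subsingleton.elim A B
    have h : (pull temperedFrobenioid.divisorMonoid f : _ → _) = fun x => x ^ ((deg f : ℕ+) : ℕ) :=
      funext fun x => Subtype.ext rfl
    rw [h]
    exact (temperedFrobenioid_isPerfect (op A)).1 _ (PNat.pos (deg f))

/-- `B = ℂˣ × (ℚ_{≥0})^gp` is a monoid on the base: every pull-back `(c, q) ↦ (c, N q)` is bijective
(the exponents are uniquely divisible). [cite: MochizukiEtTh2009, Def 3.6 p.77] -/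
theorem ratFnFunctor_isMonoidOn : IsMonoidOn temperedFrobenioid.ratFnFunctor :=
  isMonoidOn_of_bijective fun {A B} f => by
    cases Subsingleton.elim A B
    haveI : IsCancelMul (temperedFrobenioid.Φ.carrier (op A)) :=
      isIntegral_iff_isCancelMul.mp (divisorMonoid_isDivisorial A).isPreDivisorial.isIntegral
    have hG := pow_bijective_gp (temperedFrobenioid_isPerfect (op A)) (deg f)
    constructor
    · intro p q hpq
      have hv := congrArg Subtype.val hpq
      change (temperedFrobenioid.ratFnPull f.op p).1 = (temperedFrobenioid.ratFnPull f.op q).1 at hv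
      rw [TemperedFrobenioid.coe_ratFnPull, TemperedFrobenioid.coe_ratFnPull, Prod.mk.injEq,
        gpMap_pull, gpMap_pull] at hv
      have h2 : p.1.2 = q.1.2 := hG.1 hv.2
      have h1 : p.1.1.1 = q.1.1.1 := by
        have h1' := congrArg Prod.fst hv.1
        exact h1'
      have hp : p.1.1.2 = temperedFrobenioid.ΦgpToRlog _ p.1.2 := p.2
      have hq : q.1.1.2 = temperedFrobenioid.ΦgpToRlog _ q.1.2 := q.2
      apply Subtype.ext
      refine Prod.ext (Prod.ext h1 ?_) h2
      rw [hp, hq, h2]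
    · intro r
      obtain ⟨θ, hθ⟩ := hG.2 r.1.2
      have hr : r.1.1.2 = temperedFrobenioid.ΦgpToRlog _ r.1.2 := r.2
      refine ⟨⟨((r.1.1.1, temperedFrobenioid.ΦgpToRlog _ θ), θ), rfl⟩, Subtype.ext ?_⟩
      change (temperedFrobenioid.ratFnPull f.op _).1 = r.1
      rw [TemperedFrobenioid.coe_ratFnPull, gpMap_pull]
      refine Prod.ext (Prod.ext rfl ?_) hθ
      change temperedFrobenioid.ΦgpToRlog _ θ ^ ((deg f : ℕ+) : ℕ) = r.1.1.2
      rw [← map_pow, hr]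
      exact congrArg _ hθ

/-- **The Kummer-tower toy tempered Frobenioid is a Frobenioid** (REAL `PreFrobenioid.IsFrobenioid`, by
L1's [FrdI] Thm 5.2 (ii) `ModelFrobenioid.isFrobenioid`). [cite: MochizukiEtTh2009, Thm 3.7 p.79] -/
theorem temperedFrobenioid_isFrobenioid : PreFrobenioid.IsFrobenioid temperedFrobenioid.toElem :=
  ModelFrobenioid.isFrobenioid divisorMonoid_isMonoidOn divisorMonoid_isDivisorial ratFnFunctor_isMonoidOn
    ratFnFunctor_isGroupLike (isGraphConnected_iff_isConnected.2 temperedFrobenioid.isConnected)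
    temperedFrobenioid.isTotallyEpimorphic

/-! ## Thm 4.4 (i)–(iv) fire for the identity self-equivalence -/

/-- `H_⊙ = Π^tp_X` (the Galois surjection is trivial). [cite: MochizukiEtTh2009, Def 4.1 p.86] -/
private theorem hodot_eq_top' : biKummerSetting.Hodot = ⊤ :=
  MonoidHom.ker_one

/-- **Thm 4.4 (i)–(iv) FIRE at the Kummer-tower toy** for the identity self-equivalence `Ψ = Ψ^bs = 𝟭`
(an inhabitant of abc-iut-L2-t3's `Thm44Hyp`, built inline: `Φ` non-dilating = vocabulary slot, `D = D₀[∗]`,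
`H_⊙ = Π^tp_X` open) and `ψ = id`: the closers `thm44_i_of_inputs` ("`C₂` is a Frobenioid" REAL, T44-L03,
T44-L09c, T44-L09), `thm44_ii_of_subnodes` (T44-L03, L10, L12), `thm44_iii_of_inputs` (T44-L03, reflected
Frobenius type, Frobenioid, T44-L15b) and `thm44_iv_of_prop43_ii` all apply.
[cite: MochizukiEtTh2009, Thm 4.4 p.94] -/
theorem thm44_id :
    ∃ (h : BiKummerSetting.Thm44Hyp biKummerSetting biKummerSetting)
      (ψ : ∀ A : biKummerSetting.C, biKummerSetting.biratUnits A ≃* biKummerSetting.biratUnits (h.Ψ.functor.obj A)),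
      BiKummerSetting.Thm44_i h ∧ BiKummerSetting.Thm44_ii h ψ ∧ BiKummerSetting.Thm44_iii h ψ ∧
        BiKummerSetting.Thm44_iv h ψ (fun {_ _} φ => temperedFrobenioid.pullFracModel φ)
          (fun {_ _} φ => temperedFrobenioid.pullFracModel φ) := by
  let h : BiKummerSetting.Thm44Hyp biKummerSetting biKummerSetting :=
    { isNonDilating₁ := fun _ _ => trivial
      isNonDilating₂ := fun _ _ => trivial
      baseShape₁ := ⟨(inferInstance : (𝟭 Base).Full), (inferInstance : (𝟭 Base).Faithful), pt,
        fun Y => ⟨fun _ => ⟨cover Y pt 1⟩, fun _ => ⟨Y, ⟨Iso.refl _⟩⟩⟩⟩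
      baseShape₂ := ⟨(inferInstance : (𝟭 Base).Full), (inferInstance : (𝟭 Base).Faithful), pt,
        fun Y => ⟨fun _ => ⟨cover Y pt 1⟩, fun _ => ⟨Y, ⟨Iso.refl _⟩⟩⟩⟩
      isOpen_Hodot₁ := by rw [hodot_eq_top', Subgroup.coe_top]; exact isOpen_univ
      isOpen_Hodot₂ := by rw [hodot_eq_top', Subgroup.coe_top]; exact isOpen_univ
      Ψ := CategoryTheory.Equivalence.refl
      Ψbs := CategoryTheory.Equivalence.refl
      comm := biKummerSetting.base.rightUnitor ≪≫ biKummerSetting.base.leftUnitor.symm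
      mapsAodot := ⟨Iso.refl _⟩ }
  have hPFS : h.PreservesFrobeniusStructure := ⟨fun _ _ _ => rfl, fun _ _ _ h => h, fun _ _ _ h => h, fun _ _ _ h => h⟩
  have hHodot : h.HodotCompatible := ⟨ContinuousMulEquiv.refl _, Subgroup.map_id _⟩
  have hGal : h.GaloisCompatible := fun A _ =>
    ⟨trivial, Subgroup.ext fun σ => by
      rw [aut_eq_one _ σ]
      exact ⟨fun _ => one_mem _, fun _ => one_mem _⟩⟩
  have hBirat : h.BiratCompatible fun _ => MulEquiv.refl _ :=
    ⟨fun _ _ _ _ => rfl, fun _ _ _ _ _ _ _ _ => rfl, fun _ _ => rfl⟩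
  have hPDS : h.PreservesDisjointSupports := fun _ _ _ _ h => h
  have hPNH : h.PreservesNHSaturatedBsFld := fun _ _ _ _ _ => Iff.rfl
  exact ⟨h, fun _ => MulEquiv.refl _,
    h.thm44_i_of_inputs temperedFrobenioid_isFrobenioid hPFS hGal hHodot,
    h.thm44_ii_of_subnodes _ hPFS hBirat hPDS,
    h.thm44_iii_of_inputs _ hPFS (fun _ _ _ h => h) temperedFrobenioid_isFrobenioid hPNH,
    BiKummerSetting.thm44_iv_of_prop43_ii h (fun _ => MulEquiv.refl _)
      (fun {_ _} φ => temperedFrobenioid.pullFracModel φ) (fun {_ _} φ => temperedFrobenioid.pullFracModel φ)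
      prop43_ii⟩

/-! ## The whole typed §4 picture at one setting with coverings -/

/-- **The §4 picture WITH ROOTS at one explicit setting**: `ToyCov.biKummerSetting` (built through
`mkOfModelCanonical`; `Φ = ℚ_{≥0}` divisorial and perfect, `B` group-like, every object `μ_N`-saturated) IS a
Frobenioid, the covering input L01a (`RootOverCovering`, ERRATUM E2) HOLDS there, and the typed
Prop 4.2 (i), (ii), (iii), (iv), Prop 4.3 (ii), (iii) and Thm 4.4 (i)–(iv) (identity self-equivalence,
`ψ = id`) hold there SIMULTANEOUSLY.  With `Toy.not_prop42_iii` (p422428): Prop 4.2 (iii) is independent of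
the other typed §4 statements plus the setting axioms, and consistent with them.
[cite: MochizukiEtTh2009, Prop 4.2 p.88] -/
theorem sec4_picture_with_roots :
    PreFrobenioid.IsFrobenioid temperedFrobenioid.toElem ∧
      BiKummerSetting.Prop42Sub.RootOverCovering biKummerSetting
        (fun {_ _} φ x => temperedFrobenioid.pullFracModel φ x) ∧
      biKummerSetting.Prop42_i ∧ biKummerSetting.Prop42_ii ∧
      biKummerSetting.Prop42_iii (fun {_ _} φ x => temperedFrobenioid.pullFracModel φ x) ∧
      biKummerSetting.Prop42_iv (fun φ x => temperedFrobenioid.pullFracModel φ x) ∧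
      (biKummerSetting.Prop43_ii fun {_ _} φ => temperedFrobenioid.pullFracModel φ) ∧
      (biKummerSetting.Prop43_iii fun {_ _} φ => temperedFrobenioid.pullFracModel φ) ∧
      ∃ (h : BiKummerSetting.Thm44Hyp biKummerSetting biKummerSetting)
        (ψ : ∀ A : biKummerSetting.C, biKummerSetting.biratUnits A ≃* biKummerSetting.biratUnits (h.Ψ.functor.obj A)),
        BiKummerSetting.Thm44_i h ∧ BiKummerSetting.Thm44_ii h ψ ∧ BiKummerSetting.Thm44_iii h ψ ∧
          BiKummerSetting.Thm44_iv h ψ (fun {_ _} φ => temperedFrobenioid.pullFracModel φ)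
            (fun {_ _} φ => temperedFrobenioid.pullFracModel φ) :=
  ⟨temperedFrobenioid_isFrobenioid, rootOverCovering, prop42_i_and_ii.1, prop42_i_and_ii.2, prop42_iii,
    prop42_iv, prop43_ii, prop43_iii, thm44_id⟩

end ToyCov

end Literature.AnabelianGeometry.EtaleTheta

end
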